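import Literature.Analysis.FluidPDE.OnsagerBDSVGluing
import Literature.Analysis.FunctionSpaces.TorusInverseLaplacianCalculus
import HarnessLib

/-!
# The BDSV gluing stage: calculus of `curl` and of the Biot–Savart potential `ℬ` on `T³`

Buckmaster–De Lellis–Székelyhidi–Vicol, *Onsager's conjecture for admissible weak solutions*,
CPAM 72 (2019) = arXiv:1701.08678, §3.3, use the vector potentials
`zᵢ = ℬvᵢ := (-Δ)⁻¹ curl vᵢ` of the exact solutions ("where `ℬ` is the Biot–Savart operator, so that
`div zᵢ = 0` and `curl zᵢ = vᵢ`"), and in §4.4 rewrite the glued stress through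
`vᵢ - vᵢ₊₁ = curl (zᵢ - zᵢ₊₁)` ("Recall that `vᵢ = curl zᵢ`"), commuting `∂ₜ` and `ℛ curl` freely.
For the accepted `BDSV.curl` and `BDSV.biotSavart` (`OnsagerBDSVGluing.lean`) this file proves
the classical identities behind these lines, for smooth fields on `T³`:

* `BDSV.curlMatrix`, `BDSV.jacobian`, `BDSV.curl_eq_curlMatrix_jacobian`: `curl v (x)` is a fixed
  linear map of the matrix `(∂ₖvᵢ(x))`; hence smoothness (`BDSV.isSmooth_curl`), linearity
  (`BDSV.curl_add`, `_sub`, `_neg`, `_const_smul`, `_zero`), `∂ⱼ curl = curl ∂ⱼ`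
  (`BDSV.partialDeriv_curl`), `Δ⁻¹ curl = curl Δ⁻¹` (`BDSV.invLaplacian_curl`);
* `BDSV.divergence_curl` (`div curl = 0`) and `BDSV.curl_curl_of_isDivFree`
  (`curl curl v = -Δv` for `div v = 0`; Schwarz);
* `BDSV.biotSavart`: smoothness, linearity, `div ℬv = 0` (`BDSV.divergence_biotSavart`) and
  **`curl ℬv = v - ∫v`** for divergence-free `v` (`BDSV.curl_biotSavart`; so `curl zᵢ = vᵢ` exactly
  when `vᵢ` has zero mean, which is how it is used for the mean-free differences `vᵢ - vᵢ₊₁`,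
  `vᵢ - v_ℓ`);
* time-dependent fields on `[a,b] × T³`: joint smoothness of `curl u`, `ℬu`
  (`BDSV.isSmoothSpaceTimeOn_curl`, `BDSV.isSmoothSpaceTimeOn_biotSavart`) and `∂ₜ curl = curl ∂ₜ`, `∂ₜℬ = ℬ∂ₜ`
  (`BDSV.timeDerivWithin_curl_comm`, `BDSV.timeDerivWithin_biotSavart_comm`).

## References

* T. Buckmaster, C. De Lellis, L. Székelyhidi Jr., V. Vicol, *Onsager's conjecture for admissible
  weak solutions*, Comm. Pure Appl. Math. 72 (2019) 229–274 = arXiv:1701.08678, §3.3 (vector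
  potentials), §4.4 (proof of Prop. 4.3).
* A. J. Majda, A. L. Bertozzi, *Vorticity and incompressible flow*, CUP 2002, §2.4.1
  (`curl curl = ∇div - Δ`, Biot–Savart).
-/

noncomputable section

open MeasureTheory Set Filter Function
open scoped ContDiff

namespace Literature.Analysis.FluidPDE

namespace BDSV

open FunctionSpaces FunctionSpaces.Torus

/-- The flat three-torus `T³ = (ℝ/ℤ)³`, local notation. -/
local notation "𝕋³" => UnitAddTorus (Fin 3)

/-- Euclidean `ℝ³`, local notation. -/
local notation "ℝ³" => EuclideanSpace ℝ (Fin 3)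

/-! ## `curl` as a linear map of the Jacobian matrix -/

section CurlMatrix

/-- The linear map `(Dₖᵢ) ↦ (D₁₂ - D₂₁, D₂₀ - D₀₂, D₀₁ - D₁₀)` computing a curl from a matrix of
partial derivatives `Dₖᵢ = ∂ₖvᵢ`. [folklore] -/
def curlMatrixLM : (Fin 3 → Fin 3 → ℝ) →ₗ[ℝ] ℝ³ where
  toFun D := WithLp.toLp 2 ![D 1 2 - D 2 1, D 2 0 - D 0 2, D 0 1 - D 1 0]
  map_add' D D' := by
    ext i
    fin_cases i <;> simp <;> ring
  map_smul' c D := by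
    ext i
    fin_cases i <;> simp <;> ring

/-- `BDSV.curlMatrixLM` as a continuous linear map. [folklore] -/
def curlMatrix : (Fin 3 → Fin 3 → ℝ) →L[ℝ] ℝ³ :=
  LinearMap.toContinuousLinearMap curlMatrixLM

/-- The formula of `BDSV.curlMatrix`. [folklore] -/
@[simp]
theorem curlMatrix_apply (D : Fin 3 → Fin 3 → ℝ) :
    curlMatrix D = WithLp.toLp 2 ![D 1 2 - D 2 1, D 2 0 - D 0 2, D 0 1 - D 1 0] := rfl

/-- The matrix of partial derivatives `(∂ₖvᵢ(x))ₖᵢ` of a vector field on `T³`. [folklore] -/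
def jacobian (v : 𝕋³ → ℝ³) (x : 𝕋³) : Fin 3 → Fin 3 → ℝ :=
  fun k i => partialDeriv k v x i

/-- `curl v (x) = curlMatrix (∂ₖvᵢ(x))`. [folklore] -/
theorem curl_eq_curlMatrix_jacobian (v : 𝕋³ → ℝ³) (x : 𝕋³) : curl v x = curlMatrix (jacobian v x) := rfl

/-- `curl v = curlMatrix ∘ jacobian v`. [folklore] -/
theorem curl_eq_comp (v : 𝕋³ → ℝ³) : curl v = curlMatrix ∘ jacobian v := rfl

variable {v w : 𝕋³ → ℝ³}

/-- The evaluation `M ↦ M k i` as a continuous linear map. [folklore] -/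
def matrixEntry (k i : Fin 3) : (Fin 3 → Fin 3 → ℝ) →L[ℝ] ℝ :=
  (ContinuousLinearMap.proj (R := ℝ) (φ := fun _ : Fin 3 => ℝ) i).comp
    (ContinuousLinearMap.proj (R := ℝ) (φ := fun _ : Fin 3 => Fin 3 → ℝ) k)

/-- `matrixEntry k i M = M k i`. [folklore] -/
@[simp]
theorem matrixEntry_apply (k i : Fin 3) (M : Fin 3 → Fin 3 → ℝ) : matrixEntry k i M = M k i := rfl

/-- The Jacobian matrix of a smooth field is smooth. [folklore] -/
theorem isSmooth_jacobian (hv : IsSmooth v) : IsSmooth (jacobian v) := by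
  unfold IsSmooth
  rw [contDiff_pi]
  intro k
  rw [contDiff_pi]
  intro i
  have h : (fun y => lift (jacobian v) y k i) = lift (fun x => partialDeriv k v x i) := rfl
  rw [h]
  have hc : IsSmooth (fun x => partialDeriv k v x i) := (hv.partialDeriv k).comp_clm (EuclideanSpace.proj i)
  exact hc

/-- **Smoothness of the curl** of a smooth field on `T³`. [folklore] -/
theorem isSmooth_curl (hv : IsSmooth v) : IsSmooth (curl v) := by
  rw [curl_eq_comp]
  exact (isSmooth_jacobian hv).comp_clm curlMatrix

/-- The Jacobian matrix is additive on `C¹` fields. [folklore] -/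
theorem jacobian_add (hv : IsContDiff 1 v) (hw : IsContDiff 1 w) (x : 𝕋³) :
    jacobian (v + w) x = jacobian v x + jacobian w x := by
  funext k i
  simp only [jacobian, Pi.add_apply]
  rw [partialDeriv_add hv hw k]
  rfl

/-- The Jacobian matrix is homogeneous on `C¹` fields. [folklore] -/
theorem jacobian_const_smul (hv : IsContDiff 1 v) (c : ℝ) (x : 𝕋³) :
    jacobian (c • v) x = c • jacobian v x := by
  funext k i
  simp only [jacobian, Pi.smul_apply, smul_eq_mul]
  rw [partialDeriv_const_smul hv c k]
  rfl

/-- The Jacobian matrix of the zero field vanishes. [folklore] -/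
theorem jacobian_zero (x : 𝕋³) : jacobian (0 : 𝕋³ → ℝ³) x = 0 := by
  funext k i
  simp [jacobian, partialDeriv, Torus.lineDeriv]

/-- `curl (v + w) = curl v + curl w` for `C¹` fields. [folklore] -/
theorem curl_add (hv : IsContDiff 1 v) (hw : IsContDiff 1 w) (x : 𝕋³) :
    curl (v + w) x = curl v x + curl w x := by
  rw [curl_eq_curlMatrix_jacobian, jacobian_add hv hw, map_add]
  rfl

/-- `curl (c • v) = c • curl v` for `C¹` fields. [folklore] -/
theorem curl_const_smul (hv : IsContDiff 1 v) (c : ℝ) (x : 𝕋³) :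
    curl (c • v) x = c • curl v x := by
  rw [curl_eq_curlMatrix_jacobian, jacobian_const_smul hv, map_smul]
  rfl

/-- `curl 0 = 0`. [folklore] -/
theorem curl_zero (x : 𝕋³) : curl (0 : 𝕋³ → ℝ³) x = 0 := by
  rw [curl_eq_curlMatrix_jacobian, jacobian_zero, map_zero]

/-- `curl (-v) = -curl v` for `C¹` fields. [folklore] -/
theorem curl_neg (hv : IsContDiff 1 v) (x : 𝕋³) : curl (-v) x = -curl v x := by
  rw [← neg_one_smul ℝ v, curl_const_smul hv, neg_one_smul]

/-- `curl (v - w) = curl v - curl w` for `C¹` fields. [folklore] -/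
theorem curl_sub (hv : IsContDiff 1 v) (hw : IsContDiff 1 w) (x : 𝕋³) :
    curl (v - w) x = curl v x - curl w x := by
  have hw' : IsContDiff 1 (-w) := hw.neg
  rw [sub_eq_add_neg, curl_add hv hw', curl_neg hw, sub_eq_add_neg]

/-- `curl (fun y => v y - w y) = …` (function form of `BDSV.curl_sub`). [folklore] -/
theorem curl_fun_sub (hv : IsContDiff 1 v) (hw : IsContDiff 1 w) (x : 𝕋³) :
    curl (fun y => v y - w y) x = curl v x - curl w x :=
  curl_sub hv hw x

/-- Entries of the derivative of the Jacobian matrix: `∂ⱼ(∂ₖvᵢ) = (∂ⱼ∂ₖv)ᵢ`. [folklore] -/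
theorem partialDeriv_jacobian (hv : IsSmooth v) (j : Fin 3) (x : 𝕋³) (k i : Fin 3) :
    partialDeriv j (jacobian v) x k i = partialDeriv j (partialDeriv k v) x i := by
  have h1 : partialDeriv j (jacobian v) x k i = partialDeriv j (matrixEntry k i ∘ jacobian v) x := by
    rw [partialDeriv_clm_comp (isSmooth_jacobian hv) (matrixEntry k i) j x]
    rfl
  have h2 : (matrixEntry k i ∘ jacobian v) = fun y => partialDeriv k v y i := rfl
  rw [h1, h2, partialDeriv_apply_coord ((hv.partialDeriv k).isContDiff (by simp)) j x i]

/-- **`∂ⱼ curl v = curl ∂ⱼv`** for smooth `v`. [folklore] -/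
theorem partialDeriv_curl (hv : IsSmooth v) (j : Fin 3) (x : 𝕋³) :
    partialDeriv j (curl v) x = curl (partialDeriv j v) x := by
  rw [curl_eq_comp, partialDeriv_clm_comp (isSmooth_jacobian hv) curlMatrix j x, curl_eq_curlMatrix_jacobian]
  congr 1
  funext k i
  rw [partialDeriv_jacobian hv j x k i, jacobian, partialDeriv_comm hv j k x]

/-- **`Δ⁻¹(curl w) = curl (Δ⁻¹w)`** for smooth `w` ("`ℛ curl` is a zero-order operator": `Δ⁻¹`
commutes with derivatives and with the fixed linear map `curlMatrix`). [folklore] -/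
theorem invLaplacian_curl (hw : IsSmooth w) (x : 𝕋³) :
    invLaplacian (curl w) x = curl (invLaplacian w) x := by
  rw [curl_eq_comp, invLaplacian_clm_comp (isSmooth_jacobian hw) curlMatrix, comp_apply, curl_eq_curlMatrix_jacobian]
  congr 1
  funext k i
  have h1 : invLaplacian (jacobian w) x k i = invLaplacian (matrixEntry k i ∘ jacobian w) x := by
    rw [invLaplacian_clm_comp (isSmooth_jacobian hw) (matrixEntry k i)]
    rfl
  have h2 : (matrixEntry k i ∘ jacobian w) = (EuclideanSpace.proj i : ℝ³ →L[ℝ] ℝ) ∘ partialDeriv k w := rfl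
  rw [h1, h2, invLaplacian_clm_comp (hw.partialDeriv k), comp_apply, jacobian,
    partialDeriv_invLaplacian hw k x]
  rfl

end CurlMatrix

/-! ## `div curl = 0` and `curl curl = -Δ` on divergence-free fields -/

section Identities

variable {v : 𝕋³ → ℝ³}

/-- `(curl v)₀ = ∂₁v₂ - ∂₂v₁`. [folklore] -/
theorem curl_apply_zero (v : 𝕋³ → ℝ³) (x : 𝕋³) :
    curl v x 0 = partialDeriv 1 v x 2 - partialDeriv 2 v x 1 := by
  simp [curl_eq_curlMatrix_jacobian, jacobian]

/-- `(curl v)₁ = ∂₂v₀ - ∂₀v₂`. [folklore] -/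
theorem curl_apply_one (v : 𝕋³ → ℝ³) (x : 𝕋³) :
    curl v x 1 = partialDeriv 2 v x 0 - partialDeriv 0 v x 2 := by
  simp [curl_eq_curlMatrix_jacobian, jacobian]

/-- `(curl v)₂ = ∂₀v₁ - ∂₁v₀`. [folklore] -/
theorem curl_apply_two (v : 𝕋³ → ℝ³) (x : 𝕋³) :
    curl v x 2 = partialDeriv 0 v x 1 - partialDeriv 1 v x 0 := by
  simp [curl_eq_curlMatrix_jacobian, jacobian]

/-- Schwarz in coordinates: `(∂ⱼ∂ₖv)ᵢ = (∂ₖ∂ⱼv)ᵢ` for smooth `v`. [folklore] -/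
theorem partialDeriv_partialDeriv_apply_comm (hv : IsSmooth v) (x : 𝕋³) (j k i : Fin 3) :
    partialDeriv j (partialDeriv k v) x i = partialDeriv k (partialDeriv j v) x i := by
  rw [partialDeriv_comm hv j k x]

/-- **`div (curl v) = 0`** for smooth `v` (Schwarz). [folklore] -/
theorem divergence_curl (hv : IsSmooth v) (x : 𝕋³) : divergence (curl v) x = 0 := by
  rw [divergence_eq_sum_partialDeriv_apply ((isSmooth_curl hv).isContDiff (by simp))]
  simp only [Fin.sum_univ_three, partialDeriv_curl hv, curl_apply_zero, curl_apply_one, curl_apply_two]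
  rw [partialDeriv_partialDeriv_apply_comm hv x 0 1 2, partialDeriv_partialDeriv_apply_comm hv x 0 2 1, partialDeriv_partialDeriv_apply_comm hv x 1 2 0]
  ring

/-- **`curl (curl v) = -Δv` for smooth divergence-free `v`** (`curl curl = ∇ div - Δ` and
`div v = 0`; Majda–Bertozzi §2.4.1). [folklore] -/
theorem curl_curl_of_isDivFree (hv : IsSmooth v) (hdiv : IsDivFree v) (x : 𝕋³) :
    curl (curl v) x = -Torus.laplacian v x := by
  -- the derivative of `div v = ∑ₘ ∂ₘvₘ ≡ 0`
  have hdiv0 : ∀ i : Fin 3, ∑ m : Fin 3, partialDeriv i (partialDeriv m v) x m = 0 := by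
    intro i
    have hd : divergence v = fun _ => (0 : ℝ) := funext hdiv
    have h1 : partialDeriv i (divergence v) x = 0 := by
      rw [hd]
      simp [partialDeriv, Torus.lineDeriv]
    have h2 : partialDeriv i (divergence v) x = ∑ m : Fin 3, partialDeriv i (partialDeriv m v) x m := by
      have e : divergence v = fun y => ∑ m : Fin 3, partialDeriv m (fun z => v z m) y := rfl
      rw [e, partialDeriv_finset_sum _ (fun m _ => ((hv.apply m).partialDeriv m).isContDiff (by simp))]
      refine Finset.sum_congr rfl fun m _ => ?_
      have e2 : partialDeriv m (fun z => v z m) = fun z => partialDeriv m v z m :=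
        funext fun z => partialDeriv_apply_coord (hv.isContDiff (by simp)) m z m
      rw [e2, partialDeriv_apply_coord ((hv.partialDeriv m).isContDiff (by simp)) i x m]
    rw [← h2, h1]
  -- coordinates of the Laplacian
  have hlap : ∀ i : Fin 3, Torus.laplacian v x i = ∑ m : Fin 3, partialDeriv m (partialDeriv m v) x i := by
    intro i
    rw [laplacian_eq_sum_partialDeriv_partialDeriv hv]
    simp [Finset.sum_apply]
  -- expand both sides in coordinates
  ext i
  have hc : IsSmooth (curl v) := (isSmooth_curl hv)
  fin_cases i
  · simp only [Fin.zero_eta, PiLp.neg_apply]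
    rw [curl_apply_zero, partialDeriv_curl hv, partialDeriv_curl hv, curl_apply_two, curl_apply_one, hlap 0]
    have h0 := hdiv0 0
    simp only [Fin.sum_univ_three] at h0 ⊢
    linarith
  · simp only [Fin.mk_one, PiLp.neg_apply]
    rw [curl_apply_one, partialDeriv_curl hv, partialDeriv_curl hv, curl_apply_zero, curl_apply_two, hlap 1]
    have h0 := hdiv0 1
    simp only [Fin.sum_univ_three] at h0 ⊢
    linarith
  · simp only [Fin.reduceFinMk, PiLp.neg_apply]
    rw [curl_apply_two, partialDeriv_curl hv, partialDeriv_curl hv, curl_apply_one, curl_apply_zero, hlap 2]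
    have h0 := hdiv0 2
    simp only [Fin.sum_univ_three] at h0 ⊢
    linarith

end Identities

/-! ## The Biot–Savart potential -/

section BiotSavart

variable {v w : 𝕋³ → ℝ³}

/-- `ℬv = -Δ⁻¹(curl v)` as functions. [folklore] -/
theorem biotSavart_eq (v : 𝕋³ → ℝ³) : biotSavart v = -invLaplacian (curl v) := rfl

/-- **`ℬv` is smooth** for smooth `v`. [folklore] -/
theorem isSmooth_biotSavart (hv : IsSmooth v) : IsSmooth (biotSavart v) := by
  rw [biotSavart_eq]
  exact (isSmooth_invLaplacian (isSmooth_curl hv)).neg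

/-- `ℬ` is additive on smooth fields. [folklore] -/
theorem biotSavart_add (hv : IsSmooth v) (hw : IsSmooth w) :
    biotSavart (v + w) = biotSavart v + biotSavart w := by
  have hc : curl (v + w) = curl v + curl w :=
    funext fun x => curl_add (hv.isContDiff (by simp)) (hw.isContDiff (by simp)) x
  rw [biotSavart_eq, biotSavart_eq, biotSavart_eq, hc, invLaplacian_add (isSmooth_curl hv) (isSmooth_curl hw), neg_add]

/-- `ℬ(c • v) = c • ℬv` for smooth `v`. [folklore] -/
theorem biotSavart_const_smul (hv : IsSmooth v) (c : ℝ) : biotSavart (c • v) = c • biotSavart v := by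
  have hc : curl (c • v) = c • curl v := funext fun x => curl_const_smul (hv.isContDiff (by simp)) c x
  rw [biotSavart_eq, biotSavart_eq, hc, invLaplacian_const_smul c _ (isSmooth_curl hv), smul_neg]

/-- `ℬ(-v) = -ℬv` for smooth `v`. [folklore] -/
theorem biotSavart_neg (hv : IsSmooth v) : biotSavart (-v) = -biotSavart v := by
  rw [← neg_one_smul ℝ v, biotSavart_const_smul hv, neg_one_smul]

/-- `ℬ(v - w) = ℬv - ℬw` for smooth fields. [folklore] -/
theorem biotSavart_sub (hv : IsSmooth v) (hw : IsSmooth w) :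
    biotSavart (v - w) = biotSavart v - biotSavart w := by
  rw [sub_eq_add_neg, biotSavart_add hv hw.neg, biotSavart_neg hw, sub_eq_add_neg]

/-- `ℬ(v - w) = ℬv - ℬw`, function form. [folklore] -/
theorem biotSavart_fun_sub (hv : IsSmooth v) (hw : IsSmooth w) (x : 𝕋³) :
    biotSavart (fun y => v y - w y) x = biotSavart v x - biotSavart w x := by
  have h := congr_fun (biotSavart_sub hv hw) x
  exact h

/-- `ℬ 0 = 0`. [folklore] -/
theorem biotSavart_zero : biotSavart (0 : 𝕋³ → ℝ³) = 0 := by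
  have hc : curl (0 : 𝕋³ → ℝ³) = 0 := funext curl_zero
  rw [biotSavart_eq, hc, invLaplacian_zero, neg_zero]

/-- `curl (ℬv) = -curl Δ⁻¹ curl v = -Δ⁻¹(curl curl v)`. [folklore] -/
theorem curl_biotSavart_eq (hv : IsSmooth v) (x : 𝕋³) :
    curl (biotSavart v) x = -invLaplacian (curl (curl v)) x := by
  rw [biotSavart_eq, curl_neg ((isSmooth_invLaplacian (isSmooth_curl hv)).isContDiff (by simp)), invLaplacian_curl (isSmooth_curl hv)]

/-- **`curl ℬv = v - ∫v` for smooth divergence-free `v`** (BDSV §3.3: "`curl zᵢ = vᵢ`", for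
mean-free fields): `curl ℬv = -Δ⁻¹(curl curl v) = Δ⁻¹(Δv) = v - ∫v`. [cite: BuckmasterEtAl2018, §3.3 (vector potentials)] -/
theorem curl_biotSavart (hv : IsSmooth v) (hdiv : IsDivFree v) (x : 𝕋³) :
    curl (biotSavart v) x = v x - ∫ y, v y := by
  have hcc : curl (curl v) = -Torus.laplacian v := funext (curl_curl_of_isDivFree hv hdiv)
  rw [curl_biotSavart_eq hv, hcc, invLaplacian_neg hv.laplacian, Pi.neg_apply, neg_neg,
    invLaplacian_laplacian hv x]

/-- In particular `curl ℬv = v` for smooth divergence-free mean-free `v`. [cite: BuckmasterEtAl2018, §3.3 (vector potentials)] -/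
theorem curl_biotSavart_of_integral_eq_zero (hv : IsSmooth v) (hdiv : IsDivFree v) (h0 : ∫ y, v y = 0) :
    curl (biotSavart v) = v := by
  funext x
  rw [curl_biotSavart hv hdiv x, h0, sub_zero]

/-- `div (Δ⁻¹u) = Δ⁻¹... `: the divergence commutes with `Δ⁻¹` on smooth fields. [folklore] -/
theorem divergence_invLaplacian {u : 𝕋³ → ℝ³} (hu : IsSmooth u) (x : 𝕋³) :
    divergence (invLaplacian u) x = invLaplacian (fun y => divergence u y) x := by
  rw [divergence_eq_sum_partialDeriv_apply ((isSmooth_invLaplacian hu).isContDiff (by simp))]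
  have e : (fun y => divergence u y) = fun y => ∑ m : Fin 3, ((EuclideanSpace.proj m : ℝ³ →L[ℝ] ℝ) ∘ partialDeriv m u) y := by
    funext y
    rw [divergence_eq_sum_partialDeriv_apply (hu.isContDiff (by simp))]
    rfl
  rw [e, show (fun y => ∑ m : Fin 3, ((EuclideanSpace.proj m : ℝ³ →L[ℝ] ℝ) ∘ partialDeriv m u) y) =
      ∑ m : Fin 3, ((EuclideanSpace.proj m : ℝ³ →L[ℝ] ℝ) ∘ partialDeriv m u) from by
        funext y; simp [Finset.sum_apply],
    invLaplacian_finset_sum _ (fun m _ => (hu.partialDeriv m).comp_clm _), Finset.sum_apply]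
  refine Finset.sum_congr rfl fun m _ => ?_
  rw [invLaplacian_clm_comp (hu.partialDeriv m), comp_apply, ← partialDeriv_invLaplacian hu m x]
  rfl

/-- **`div ℬv = 0`** for smooth `v` (BDSV §3.3: "`div zᵢ = 0`"). [cite: BuckmasterEtAl2018, §3.3 (vector potentials)] -/
theorem divergence_biotSavart (hv : IsSmooth v) (x : 𝕋³) : divergence (biotSavart v) x = 0 := by
  have hneg : biotSavart v = (-1 : ℝ) • invLaplacian (curl v) := by
    rw [biotSavart_eq, neg_one_smul]
  rw [hneg, Torus.divergence_const_smul ((isSmooth_invLaplacian (isSmooth_curl hv)).isContDiff (by simp)),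
    divergence_invLaplacian (isSmooth_curl hv)]
  have h0 : (fun y => divergence (curl v) y) = 0 := funext (divergence_curl hv)
  rw [h0, invLaplacian_zero, Pi.zero_apply, mul_zero]

/-- `ℬv` is divergence free. [cite: BuckmasterEtAl2018, §3.3 (vector potentials)] -/
theorem isDivFree_biotSavart (hv : IsSmooth v) : IsDivFree (biotSavart v) :=
  divergence_biotSavart hv

end BiotSavart

/-! ## Time-dependent fields -/

section Time

variable {S : Set ℝ} {u : ℝ → 𝕋³ → ℝ³} {a b : ℝ}

/-- The Jacobian matrices of a jointly smooth field are jointly smooth (time sets of unique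
differentiability). [folklore] -/
theorem isSmoothSpaceTimeOn_jacobian (hu : IsSmoothSpaceTimeOn S u) (hS : UniqueDiffOn ℝ S) :
    IsSmoothSpaceTimeOn S (fun t => jacobian (u t)) := by
  unfold IsSmoothSpaceTimeOn
  rw [contDiffOn_pi]
  intro k
  rw [contDiffOn_pi]
  intro i
  exact ((hu.partialDeriv hS k).apply i)

/-- **The curl of a jointly smooth field is jointly smooth.** [folklore] -/
theorem isSmoothSpaceTimeOn_curl (hu : IsSmoothSpaceTimeOn S u) (hS : UniqueDiffOn ℝ S) :
    IsSmoothSpaceTimeOn S (fun t => curl (u t)) := by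
  have h : (fun t => curl (u t)) = fun t x => curlMatrix (jacobian (u t) x) := rfl
  rw [h]
  exact (isSmoothSpaceTimeOn_jacobian hu hS).clm_comp curlMatrix

/-- **The Biot–Savart potential of a jointly smooth field is jointly smooth** on convex time sets
with nonempty interior. [folklore] -/
theorem isSmoothSpaceTimeOn_biotSavart (hu : IsSmoothSpaceTimeOn S u) (hS : Convex ℝ S)
    (hSi : (interior S).Nonempty) : IsSmoothSpaceTimeOn S (fun t => biotSavart (u t)) := by
  have h : (fun t => biotSavart (u t)) = fun t x => -(invLaplacian (curl (u t)) x) := rfl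
  rw [h]
  exact ((isSmoothSpaceTimeOn_curl hu (uniqueDiffOn_convex hS hSi)).invLaplacian hS hSi).neg

/-- **`∂ₜ curl = curl ∂ₜ`** for jointly smooth fields on `[a,b] × T³`. [folklore] -/
theorem timeDerivWithin_curl_comm (hab : a < b) (hu : IsSmoothSpaceTimeOn (Icc a b) u) {t : ℝ}
    (ht : t ∈ Icc a b) (x : 𝕋³) :
    timeDerivWithin (Icc a b) (fun s => curl (u s)) t x = curl (timeDerivWithin (Icc a b) u t) x := by
  have hS : UniqueDiffOn ℝ (Icc a b) := uniqueDiffOn_Icc hab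
  have h : (fun s => curl (u s)) = fun s y => curlMatrix (jacobian (u s) y) := rfl
  rw [h, timeDerivWithin_clm_comp (isSmoothSpaceTimeOn_jacobian hu hS) hS curlMatrix ht x, curl_eq_curlMatrix_jacobian]
  congr 1
  funext k i
  -- entries: `∂ₜ(∂ₖuᵢ) = ∂ₖ(∂ₜu)ᵢ`
  have e1 : timeDerivWithin (Icc a b) (fun s => jacobian (u s)) t x k i =
      timeDerivWithin (Icc a b) (fun s y => matrixEntry k i (jacobian (u s) y)) t x := by
    rw [timeDerivWithin_clm_comp (isSmoothSpaceTimeOn_jacobian hu hS) hS (matrixEntry k i) ht x]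
    rfl
  have e2 : (fun s y => matrixEntry k i (jacobian (u s) y)) =
      fun s y => (EuclideanSpace.proj i : ℝ³ →L[ℝ] ℝ) (partialDeriv k (u s) y) := rfl
  rw [e1, e2, timeDerivWithin_clm_comp (hu.partialDeriv hS k) hS _ ht x,
    timeDerivWithin_partialDeriv_comm hab hu ht k x]
  rfl

/-- **`∂ₜℬ = ℬ∂ₜ`** for jointly smooth fields on `[a,b] × T³`. [folklore] -/
theorem timeDerivWithin_biotSavart_comm (hab : a < b) (hu : IsSmoothSpaceTimeOn (Icc a b) u) {t : ℝ}
    (ht : t ∈ Icc a b) (x : 𝕋³) :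
    timeDerivWithin (Icc a b) (fun s => biotSavart (u s)) t x = biotSavart (timeDerivWithin (Icc a b) u t) x := by
  have hS : UniqueDiffOn ℝ (Icc a b) := uniqueDiffOn_Icc hab
  have hint : (interior (Icc a b)).Nonempty := by
    rw [interior_Icc]; exact nonempty_Ioo.2 hab
  have hc : IsSmoothSpaceTimeOn (Icc a b) (fun s => curl (u s)) := isSmoothSpaceTimeOn_curl hu hS
  have hI : IsSmoothSpaceTimeOn (Icc a b) (fun s => invLaplacian (curl (u s))) :=
    hc.invLaplacian (convex_Icc a b) hint
  have h : (fun s => biotSavart (u s)) = fun s y => (-1 : ℝ) • invLaplacian (curl (u s)) y := by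
    funext s y
    rw [neg_one_smul]
    rfl
  rw [h, timeDerivWithin_const_smul hI hS (-1) ht x, timeDerivWithin_invLaplacian hab hc ht x,
    neg_one_smul]
  have e : timeDerivWithin (Icc a b) (fun s => curl (u s)) t = curl (timeDerivWithin (Icc a b) u t) :=
    funext fun y => timeDerivWithin_curl_comm hab hu ht y
  rw [e]
  rfl

end Time

end BDSV

end Literature.Analysis.FluidPDE
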